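import Literature.Geometry.Manifold.LieAddGroupExponential
import Literature.Geometry.Kaehler.Kaehler
import Literature.NumberTheory.Transcendental.ComplexFormsPullback
import HarnessLib

/-!
# The exponential map of a commutative complex Lie group is holomorphic

A complex Lie group `G` (`LieAddGroup 𝓘(ℂ, E) ω G`, additive notation) is a real Lie group for the
same charts (`Literature.Geometry.Kaehler.lieAddGroup_real_of_complex`, from
`Literature.Geometry.Kaehler.isManifold_real_of_isManifold_complex` and restriction of scalars in
charts), so the real theory of `Literature.Geometry.Manifold.LieAddGroupExponential` provides its
exponential map `lieAddExp : E → G` (smooth, `exp (v + w) = exp v + exp w` when `G` is commutative,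
a local diffeomorphism at `0`, onto a neighbourhood of `0`, generating `G`). Here:

* `Literature.Geometry.Kaehler.mfderiv_lieAddExp_eq_mfderiv_add_left` — for commutative `G`,
  `d(exp)_v = d(τ_{exp v})_0` (differentiate `exp (v + h) = exp v + exp h` at `h = 0`, using
  `(d exp)_0 = id`);
* `Literature.Geometry.Kaehler.mdifferentiable_complex_lieAddExp` — hence **`exp` is holomorphic**:
  its real differential is the restriction of scalars of the complex differential of the
  holomorphic translation `τ_{exp v}` (`mfderiv_real_eq_restrictScalars`), so the chart expression
  is complex-differentiable (`HasFDerivWithinAt.of_restrictScalars`). With the tree's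
  `Literature.NumberTheory.Transcendental.contMDiff_omega_of_mdifferentiable` this gives
  `ContMDiff 𝓘(ℂ, E) 𝓘(ℂ, E) ω exp` for finite-dimensional `E`.

This is the standard fact that the exponential map of a complex Lie group is holomorphic, in the
commutative case needed for complex tori (Lange–Birkenhake 1992, §1.1, proof of Lemma 1.1.1 / Lee
2012, Prop. 20.8 with holomorphic data). Everything is proved; no definitions.

## References

* J. M. Lee, *Introduction to Smooth Manifolds*, 2nd ed., GTM 218 (2012), Prop. 20.8. [LeeSmoothManifolds2013]
* H. Lange, Ch. Birkenhake, *Complex Abelian Varieties* (1992), §1.1. [LangeBirkenhake1992]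
-/

open scoped Manifold ContDiff Topology
open Set Function Filter

noncomputable section

namespace Literature.Geometry.Kaehler

open Literature.Geometry.Manifold

universe u

variable {E : Type u} [NormedAddCommGroup E] [NormedSpace ℂ E]
  {G : Type*} [TopologicalSpace G] [ChartedSpace E G]

/-- **A complex Lie group is a real Lie group for the same charts** (restriction of scalars in the
holomorphic group operations; the real `C^∞` atlas is `isManifold_real_of_isManifold_complex`).
Not an instance (cf. `isManifold_real_of_isManifold_complex`); use with `haveI`.
[cite: LangeBirkenhake1992, §1.1] -/
theorem lieAddGroup_real_of_complex [AddGroup G] [LieAddGroup 𝓘(ℂ, E) ω G] :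
    LieAddGroup 𝓘(ℝ, E) ∞ G := by
  haveI := isManifold_real_of_isManifold_complex (E := E) (M := G)
  have hadd : ContMDiff (𝓘(ℂ, E).prod 𝓘(ℂ, E)) 𝓘(ℂ, E) ω (fun p : G × G => p.1 + p.2) :=
    contMDiff_add 𝓘(ℂ, E) ω
  have hneg : ContMDiff 𝓘(ℂ, E) 𝓘(ℂ, E) ω (fun a : G => -a) := contMDiff_neg 𝓘(ℂ, E) ω
  have hadd' : ContMDiff (𝓘(ℝ, E).prod 𝓘(ℝ, E)) 𝓘(ℝ, E) ∞ (fun p : G × G => p.1 + p.2) := by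
    rw [contMDiff_iff] at hadd ⊢
    exact ⟨hadd.1, fun x y => ((hadd.2 x y).restrict_scalars ℝ).of_le le_top⟩
  have hneg' : ContMDiff 𝓘(ℝ, E) 𝓘(ℝ, E) ∞ (fun a : G => -a) := by
    rw [contMDiff_iff] at hneg ⊢
    exact ⟨hneg.1, fun x y => ((hneg.2 x y).restrict_scalars ℝ).of_le le_top⟩
  exact { contMDiff_add := hadd', contMDiff_neg := hneg' }

variable [AddCommGroup G] [LieAddGroup 𝓘(ℂ, E) ω G] [LieAddGroup 𝓘(ℝ, E) ∞ G] [T2Space G]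
  [CompleteSpace E]

omit [LieAddGroup 𝓘(ℂ, E) ω G] in
/-- For a commutative Lie group, **`d(exp)_v = d(τ_{exp v})_0`** (real differentials), where
`τ_g = (g + ·)`: differentiate `exp (v + h) = exp v + exp h` at `h = 0` and use `(d exp)_0 = id`.
[cite: LeeSmoothManifolds2013, Prop. 20.8 (e)] -/
theorem mfderiv_lieAddExp_eq_mfderiv_add_left (v₀ : E) (w : E) :
    mfderiv 𝓘(ℝ, E) 𝓘(ℝ, E) (fun v : E => lieAddExp (I := 𝓘(ℝ, E)) (G := G) v) v₀ w =
      mfderiv 𝓘(ℝ, E) 𝓘(ℝ, E)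
        (fun g : G => lieAddExp (I := 𝓘(ℝ, E)) (G := G) v₀ + g) (0 : G) w := by
  have hsm : ContMDiff 𝓘(ℝ, E) 𝓘(ℝ, E) ∞ (fun v : E => lieAddExp (I := 𝓘(ℝ, E)) (G := G) v) :=
    contMDiff_lieAddExp
  have hd : MDifferentiableAt 𝓘(ℝ, E) 𝓘(ℝ, E)
      (fun v : E => lieAddExp (I := 𝓘(ℝ, E)) (G := G) v) v₀ := hsm.mdifferentiableAt (by simp)
  have hd0 : MDifferentiableAt 𝓘(ℝ, E) 𝓘(ℝ, E)
      (fun v : E => lieAddExp (I := 𝓘(ℝ, E)) (G := G) v) 0 := hsm.mdifferentiableAt (by simp)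
  have hτ : MDifferentiableAt 𝓘(ℝ, E) 𝓘(ℝ, E)
      (fun g : G => lieAddExp (I := 𝓘(ℝ, E)) (G := G) v₀ + g) 0 :=
    (contMDiff_add_left (I := 𝓘(ℝ, E)) (n := ∞)).mdifferentiableAt (by simp)
  have htr : HasMFDerivAt 𝓘(ℝ, E) 𝓘(ℝ, E) (fun h : E => v₀ + h) 0 (ContinuousLinearMap.id ℝ E) :=
    hasMFDerivAt_iff_hasFDerivAt.2 ((hasFDerivAt_id (0 : E)).const_add v₀)
  have h1 := mfderiv_comp_apply_of_eq (I := 𝓘(ℝ, E)) (I' := 𝓘(ℝ, E)) (I'' := 𝓘(ℝ, E)) (0 : E)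
    (g := fun v : E => lieAddExp (I := 𝓘(ℝ, E)) (G := G) v) (f := fun h : E => v₀ + h)
    hd htr.mdifferentiableAt (add_zero v₀) w
  have h2 := mfderiv_comp_apply_of_eq (I := 𝓘(ℝ, E)) (I' := 𝓘(ℝ, E)) (I'' := 𝓘(ℝ, E)) (0 : E)
    (g := fun g : G => lieAddExp (I := 𝓘(ℝ, E)) (G := G) v₀ + g)
    (f := fun v : E => lieAddExp (I := 𝓘(ℝ, E)) (G := G) v)
    hτ hd0 (lieAddExp_zero (I := 𝓘(ℝ, E)) (G := G)) w
  have hfun : ((fun v : E => lieAddExp (I := 𝓘(ℝ, E)) (G := G) v) ∘ fun h : E => v₀ + h) =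
      ((fun g : G => lieAddExp (I := 𝓘(ℝ, E)) (G := G) v₀ + g) ∘
        fun v : E => lieAddExp (I := 𝓘(ℝ, E)) (G := G) v) := by
    funext h
    exact lieAddExp_add (I := 𝓘(ℝ, E)) (G := G) v₀ h
  rw [hfun, htr.mfderiv] at h1
  rw [mfderiv_lieAddExp_zero_apply] at h2
  exact h1.symm.trans h2

/-- **The exponential map of a commutative complex Lie group is holomorphic**: the real
differential of `exp` at `v` is the restriction of scalars of the complex differential of the
holomorphic translation by `exp v` (`mfderiv_lieAddExp_eq_mfderiv_add_left`,
`mfderiv_real_eq_restrictScalars`), so `exp` is complex-differentiable in the (shared) charts.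
[cite: LangeBirkenhake1992, §1.1] -/
theorem mdifferentiable_complex_lieAddExp :
    MDifferentiable 𝓘(ℂ, E) 𝓘(ℂ, E) (fun v : E => lieAddExp (I := 𝓘(ℝ, E)) (G := G) v) := by
  intro v₀
  have hsm : ContMDiff 𝓘(ℝ, E) 𝓘(ℝ, E) ∞ (fun v : E => lieAddExp (I := 𝓘(ℝ, E)) (G := G) v) :=
    contMDiff_lieAddExp
  have hd : MDifferentiableAt 𝓘(ℝ, E) 𝓘(ℝ, E)
      (fun v : E => lieAddExp (I := 𝓘(ℝ, E)) (G := G) v) v₀ := hsm.mdifferentiableAt (by simp)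
  have hτ : MDifferentiableAt 𝓘(ℂ, E) 𝓘(ℂ, E)
      (fun g : G => lieAddExp (I := 𝓘(ℝ, E)) (G := G) v₀ + g) 0 :=
    (contMDiff_add_left (I := 𝓘(ℂ, E)) (n := ω)).mdifferentiableAt (by simp)
  set L : E →L[ℂ] E :=
    mfderiv 𝓘(ℂ, E) 𝓘(ℂ, E) (fun g : G => lieAddExp (I := 𝓘(ℝ, E)) (G := G) v₀ + g) (0 : G)
    with hL
  have hτL : mfderiv 𝓘(ℝ, E) 𝓘(ℝ, E)
      (fun g : G => lieAddExp (I := 𝓘(ℝ, E)) (G := G) v₀ + g) (0 : G) = L.restrictScalars ℝ :=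
    Literature.NumberTheory.Transcendental.mfderiv_real_eq_restrictScalars hτ
  have hfL : mfderiv 𝓘(ℝ, E) 𝓘(ℝ, E) (fun v : E => lieAddExp (I := 𝓘(ℝ, E)) (G := G) v) v₀ =
      L.restrictScalars ℝ := by
    apply ContinuousLinearMap.ext
    intro w
    rw [mfderiv_lieAddExp_eq_mfderiv_add_left v₀ w, hτL]
    rfl
  have hreal := hd.hasMFDerivAt
  rw [hfL] at hreal
  refine HasMFDerivAt.mdifferentiableAt (f' := L) ⟨hreal.1, ?_⟩
  have h2 := hreal.2
  rw [ModelWithCorners.Boundaryless.range_eq_univ] at h2 ⊢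
  exact h2.of_restrictScalars ℝ rfl

/-- The holomorphic exponential map packaged with the real structure derived from the complex
one: for a commutative complex Lie group (`[LieAddGroup 𝓘(ℂ, E) ω G]` only), with the real Lie
group structure `lieAddGroup_real_of_complex`, `exp` is complex-differentiable.
[cite: LangeBirkenhake1992, §1.1] -/
theorem mdifferentiable_complex_lieAddExp' {E : Type u} [NormedAddCommGroup E] [NormedSpace ℂ E]
    [CompleteSpace E] {G : Type*} [TopologicalSpace G] [ChartedSpace E G] [AddCommGroup G]
    [LieAddGroup 𝓘(ℂ, E) ω G] [T2Space G] :
    haveI := lieAddGroup_real_of_complex (E := E) (G := G)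
    MDifferentiable 𝓘(ℂ, E) 𝓘(ℂ, E) (fun v : E => lieAddExp (I := 𝓘(ℝ, E)) (G := G) v) := by
  haveI := lieAddGroup_real_of_complex (E := E) (G := G)
  exact mdifferentiable_complex_lieAddExp

end Literature.Geometry.Kaehler
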